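import Literature.MathematicalPhysics.QuantumFieldTheory.Balaban1983to89.B7Eq199GeneralRec
import Literature.MathematicalPhysics.QuantumFieldTheory.Balaban1983to89.B7Eq123GeneralRec
import Literature.MathematicalPhysics.QuantumFieldTheory.Balaban1983to89.B7Prop10General

/-!
# `Balaban1983to89.B7Prop10GeneralRec` — [Balaban1985Averaging] Proposition 10 (p. 50), (201)–(206), AT A GENERAL REGULAR BACKGROUND, FOR THE RECORD's averages `ũ′ʲ` (178)∕(179) over CENTRED blocks
# ([Balaban1987RG1] (0.3)–(0.4)) — the record twin of the engine's `B7Prop10General`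

statement-level skeleton of published theorems with citation tags; proofs where landed; nothing here is a claim about the Yang–Mills mass gap

CITATION HEADER (lean-in-tree rule).  Cell `pub-ymgap`, seat `pub-ymgap-dag-n05-e` g36 (N05-REC LEAD PEN); item R1 ([3] layer), Sect. G block, file 4: the record twin of `B7Prop10General`
(lit-balaban r04).  `--kind proof --supports stmt-QuantumFields-20541` (K0⁷; count-neutral; no definition).  Sources READ: [3] = [Balaban1985Averaging] p. 50 Prop. 10, p. 49 (201)–(206), p. 45
(176)–(179), p. 44 (166)–(167), p. 26 (52)–(54) (`paper:balaban1985-cmp98-averaging`); [I] = [Balaban1987RG1] (0.3)–(0.4) pp. 252–253.  REUSED BY NAME: the engine's constants and real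
arithmetic `B7Prop10General.{C6, C4G, rhs203G, rhs204G, rhs203G_zero, rhs204G_zero, rhs203G_le, rhs204G_le, ineq205G, ineq206G, covBondBd_mono}`, `B7Prop10Flat.siteBd_mono`, `B7Prop8Flat.pow_eta_le`,
`B7Prop9General.CovBondBd`, `B7Prop9Flat.SiteBd`; the record's `B7SectEFLinearisationRec.{utilGZ, vtilGZ, uavgZ-side InLambdaZ ∕ Cond166Z ∕ Cond167Z, CovBlockBdZ}`, `BlockAveragingZd.{avgIterZ, bavgZ}`, and
this seat's `B7Eq199GeneralRec.prop9_generalZ`, `B7Eq123GeneralRec.level_dataZ`.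

WHAT IS PROVED (sorry-free; `L = 2s + 1`, `s ≥ 1`, `d ≥ 1`).  ★★`prop10_generalZ` — PROPOSITION 10 FOR THE RECORD by print's induction (201)–(206): each step is `prop9_generalZ` at the averaged background
`Ū₀ʲ = avgIterZ L U₀ j`, closed by the engine's `ineq205G`∕`ineq206G` (same constants `C₄ = C4G d L`, `C₆`); ★`prop10_generalZ'` (closed forms `2α₄Lʲη`, `C₆α₄`); `levels_of52Z` (the displayed
level hypotheses from (52) via `B7Eq123GeneralRec.level_dataZ`); ★`prop10_generalZ_of52`.
HONEST SCOPE.  Port of the engine's induction to the record's objects; the `Λ_k`-membership consequence (`B7Prop10InLambda`) and (208)∕(214) for the record are the sequel; nothing of [3]∕[I] asserted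
beyond what is proved; `HThm4Rec` UNDISCHARGED; N05 discharged of record untouched; N07 not claimable; counts unmoved (typed 28∕28 · discharged 8∕28); one finite 𝕋⁴ programme at fixed ε — nothing
continuum ∕ ℝ⁴ ∕ OS ∕ mass gap ∕ Clay.  No `def`, no `instance`, no `notation`, no `sorry`.
-/

set_option autoImplicit false

noncomputable section

open NormedSpace Finset

namespace Literature.MathematicalPhysics.QuantumFieldTheory.Balaban1983to89.B7Prop10GeneralRec

open B7Prop1Explicit hiding Site
open B7Prop1Explicit renaming Site → SiteZ
open MatrixLog B7Eq92Concrete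
open B7Eq99Concrete (R0fun R0fun_add)
open B7Prop2Explicit (rescale pdev le_pdev c2')
open B7Prop8Flat (pow_eta_le)
open B7Prop9Flat (SiteBd C5' C4')
open B7Prop10Flat (siteBd_mono)
open B7Prop9General (CovBondBd)
open B7Prop10General (C6 C4G rhs203G rhs204G rhs203G_zero rhs204G_zero rhs203G_le rhs204G_le ineq205G ineq206G covBondBd_mono)
open BlockAveragingZd (avgIterZ avgIterZ_zero avgIterZ_succ bavgZ offZ)
open B7SectCDGaugeAveragesRec (uavgZ)
open B7SectEFLinearisationRec (utilGZ utilGZ_zero utilGZ_succ vtilGZ InLambdaZ Cond166Z Cond167Z CovBlockBdZ)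
open B7Prop2Rec (AvgClosedZ C0Z)
open B7Eq123GeneralRec (level_dataZ)
open B7Eq199GeneralRec (prop9_generalZ)

variable {d : ℕ}
variable {𝔸 : Type*} [NormedRing 𝔸] [NormOneClass 𝔸] [NormedAlgebra ℂ 𝔸] [CompleteSpace 𝔸]

/-- ★★ **PROPOSITION 10 AT A GENERAL BACKGROUND, FOR THE RECORD** (p. 50), by print's induction (201)–(206): each step is `prop9_generalZ` at the averaged background `Ū₀ʲ = avgIterZ L U₀ j` with
«`α₀` replaced by `2α₀(Lʲη)²`, `α′₃` by `α₃Lʲη`, `α₄` by the right-hand side of (204), `α′₄` by the right-hand side of (203)», closed by `ineq205G`∕`ineq206G`.  Hypotheses as the engine's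
`prop10_general` (level hypotheses displayed; (176) `SiteBd u′ α₄`; (177) `CovBondBd U₀ u′ (α₄η)`; (166)–(167) `InLambdaZ L U₀ u₁ k α₃ η` on CENTRED blocks; the same explicit smallness list), with
`L = 2s + 1`, `s ≥ 1`, `d ≥ 1`.  CONCLUSION: for every `j ≤ k`, (203) `CovBondBd (Ū₀ʲ) (ũ′ʲ) (rhs203G j)` and (204) `SiteBd (ũ′ʲ) (rhs204G j)`, `ũ′ʲ = utilGZ L U₀ u′ u₁ j`.
[cite: Balaban1985Averaging, Proposition 10 p.50, (201)–(206) p.49, (176)–(179) p.45, (166)–(167) p.44; Balaban1987RG1, (0.4) p.253] -/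
theorem prop10_generalZ {L s : ℕ} (hLs : L = 2 * s + 1) (hs1 : 1 ≤ s) (hd : 1 ≤ d) {U₀ : SiteZ d → Fin d → 𝔸ˣ} {k : ℕ} {u' u₁ : SiteZ d → 𝔸ˣ}
    {α₀ α₃ α₄ η : ℝ}
    (hV : ∀ j < k, ∀ (x : SiteZ d) (κ : Fin d), avgIterZ L U₀ j x κ ∈ U1 𝔸)
    (h52 : ∀ j < k, ∀ (x : SiteZ d) (κ μ : Fin d), κ ≠ μ →
      ‖((hol (avgIterZ L U₀ j) x (plaqWord κ μ) : 𝔸ˣ) : 𝔸) - 1‖ ≤ 2 * α₀ * ((L : ℝ) ^ j * η) ^ 2)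
    (h176 : SiteBd u' α₄) (h177 : CovBondBd U₀ u' (α₄ * η)) (hu₁ : InLambdaZ L U₀ u₁ k α₃ η)
    (hη : 0 ≤ η) (hk : (L : ℝ) ^ k * η ≤ 1) (hα₀ : 0 ≤ α₀) (hα₃ : 0 ≤ α₃) (hα₃' : α₃ ≤ 1 / 50) (hα₄ : 0 ≤ α₄)
    (hs₁ : 10 * C6 d * α₄ ≤ 1) (hs₂ : 3000 * ((d : ℝ) + 1) * L * α₄ ≤ 1) (hs₃ : C4G d L * (α₀ + α₃ + α₄) ≤ 1)
    (hs₄ : 1024 * ((d : ℝ) + 1) * ((d : ℝ) + 4) * L ^ 2 * α₀ ≤ 1) (hs₅ : 32 * ((d : ℝ) + 1) ^ 2 * C6 d * L ^ 2 * α₀ ≤ 1)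
    (hs₆ : 16 * d * C5' d * C6 d * (L : ℝ) ^ 2 * α₀ ≤ 1) :
    ∀ j ≤ k, CovBondBd (avgIterZ L U₀ j) (utilGZ L U₀ u' u₁ j) (rhs203G d L j α₀ α₃ α₄ η) ∧
      SiteBd (utilGZ L U₀ u' u₁ j) (rhs204G d L j α₀ α₄ η) := by
  have hL : 2 ≤ L := by omega
  have hL1 : 1 ≤ L := by omega
  have hLr : (2 : ℝ) ≤ L := by exact_mod_cast hL
  have hdr : (0 : ℝ) ≤ d := Nat.cast_nonneg d
  have h5' : (0 : ℝ) ≤ C5' d := B7Prop10Flat.C5'_nonneg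
  have h5 : (1 : ℝ) ≤ B7Prop10Flat.C5 d := B7Prop10Flat.one_le_C5
  have h4' : (0 : ℝ) ≤ C4' d := B7Prop10Flat.C4'_nonneg
  have h6 : (2 : ℝ) ≤ C6 d := by unfold C6; linarith
  have h7 : (3 : ℝ) ≤ B7Prop10General.C7 d := by unfold B7Prop10General.C7 C6; linarith
  have hC4G : (0 : ℝ) ≤ C4G d L := by unfold C4G; positivity
  have h167 : ∀ j < k, ∀ (z : SiteZ d) (r : Fin d → Fin L),
      ‖((((uavgZ L U₀ u₁ j ((L : ℤ) • z))⁻¹ *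
          R0fun (avgIterZ L U₀ j) ((L : ℤ) • z) (uavgZ L U₀ u₁ j) ((L : ℤ) • z + offZ L r) : 𝔸ˣ)) : 𝔸) - 1‖
        ≤ α₃ * (L : ℝ) ^ (j + 1) * η := by
    have h := hu₁.2
    simp only [Cond167Z, R0fun_add] at h ⊢
    exact h
  intro j hj
  induction j with
  | zero =>
    refine ⟨?_, ?_⟩
    · rw [utilGZ_zero, avgIterZ_zero, rhs203G_zero]
      refine covBondBd_mono h177 ?_
      have : 0 ≤ C4G d L * (α₀ * α₄ + α₃ * α₄ + α₄ ^ 2) * η ^ 2 := by positivity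
      linarith
    · rw [utilGZ_zero, rhs204G_zero]; exact h176
  | succ j ih =>
    have hjk : j < k := hj
    obtain ⟨hB, hS⟩ := ih hjk.le
    have ht := (pow_eta_le hL1 hη hk hjk.le).1
    have hLt : (L : ℝ) ^ (j + 1) * η ≤ 1 := (pow_eta_le hL1 hη hk (Nat.succ_le_of_lt hjk)).1
    have hLt' : (L : ℝ) * ((L : ℝ) ^ j * η) ≤ 1 := by rw [← mul_assoc, ← pow_succ']; exact hLt
    have ht0 : 0 ≤ (L : ℝ) ^ j * η := by positivity
    set t := (L : ℝ) ^ j * η with ht_def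
    have hA := rhs203G_le (d := d) hα₄ hη ht hs₃
    have hA0 : 0 ≤ rhs203G d L j α₀ α₃ α₄ η := by unfold rhs203G; positivity
    have hT := rhs204G_le (d := d) hL hα₀ hα₄ hη ht hs₆
    have hT0 : 0 ≤ rhs204G d L j α₀ α₄ η := (norm_nonneg _).trans (hS 0)
    set V : SiteZ d → Fin d → 𝔸ˣ := avgIterZ L U₀ j with hVdef
    set α₀j : ℝ := 2 * α₀ * t ^ 2 with hα₀j
    have hα₀j0 : 0 ≤ α₀j := by positivity
    have hVU : ∀ x κ, V x κ ∈ U1 𝔸 := hV j hjk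
    have h44 : ∀ (x : SiteZ d) (κ μ : Fin d), κ ≠ μ → ‖((hol V x (plaqWord κ μ) : 𝔸ˣ) : 𝔸) - 1‖ ≤ α₀j :=
      fun x κ μ hκμ => h52 j hjk x κ μ hκμ
    have h3c : SiteBd (uavgZ L U₀ u₁ j) α₃ := fun z => hu₁.1 j hjk.le z
    have h3d : CovBlockBdZ L V (uavgZ L U₀ u₁ j) (L * (α₃ * t)) := by
      intro z r
      have := h167 j hjk z r
      calc _ ≤ α₃ * (L : ℝ) ^ (j + 1) * η := this
        _ = L * (α₃ * t) := by rw [ht_def]; ring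
    have hq : 50 * (L * (α₃ * t)) ≤ 1 := by
      have e : L * (α₃ * t) = α₃ * (L * t) := by ring
      have h1 : α₃ * (L * t) ≤ α₃ * 1 := mul_le_mul_of_nonneg_left hLt' hα₃
      rw [e]; linarith
    have hα₄j : rhs204G d L j α₀ α₄ η ≤ 1 / 10 := hT.trans (by linarith)
    have ht2 : t ^ 2 ≤ t := by nlinarith
    have hg : 16 * ((d : ℝ) + 1) ^ 2 * L ^ 2 * α₀j * rhs204G d L j α₀ α₄ η ≤ α₄ * t := by
      have e : 16 * ((d : ℝ) + 1) ^ 2 * L ^ 2 * α₀j * rhs204G d L j α₀ α₄ η =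
          (32 * ((d : ℝ) + 1) ^ 2 * L ^ 2 * α₀) * t ^ 2 * rhs204G d L j α₀ α₄ η := by rw [hα₀j]; ring
      have h1 : (32 * ((d : ℝ) + 1) ^ 2 * L ^ 2 * α₀) * t ^ 2 * rhs204G d L j α₀ α₄ η ≤
          (32 * ((d : ℝ) + 1) ^ 2 * L ^ 2 * α₀) * t ^ 2 * (C6 d * α₄) :=
        mul_le_mul_of_nonneg_left hT (by positivity)
      have h2 : (32 * ((d : ℝ) + 1) ^ 2 * L ^ 2 * α₀) * t ^ 2 * (C6 d * α₄) =
          (32 * ((d : ℝ) + 1) ^ 2 * C6 d * L ^ 2 * α₀) * (t ^ 2 * α₄) := by ring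
      have h3 : (32 * ((d : ℝ) + 1) ^ 2 * C6 d * L ^ 2 * α₀) * (t ^ 2 * α₄) ≤ 1 * (t ^ 2 * α₄) :=
        mul_le_mul_of_nonneg_right hs₅ (by positivity)
      have h4 : t ^ 2 * α₄ ≤ t * α₄ := mul_le_mul_of_nonneg_right ht2 hα₄
      rw [e]; linarith
    have hs : 1000 * ((d : ℝ) + 1) * L *
        (rhs203G d L j α₀ α₃ α₄ η + 16 * ((d : ℝ) + 1) ^ 2 * L ^ 2 * α₀j * rhs204G d L j α₀ α₄ η) ≤ 1 := by
      have h1 : rhs203G d L j α₀ α₃ α₄ η + 16 * ((d : ℝ) + 1) ^ 2 * L ^ 2 * α₀j * rhs204G d L j α₀ α₄ η ≤ 3 * α₄ * t := by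
        linarith
      have h0 : 0 ≤ 1000 * ((d : ℝ) + 1) * L := by positivity
      have h2 := mul_le_mul_of_nonneg_left h1 h0
      have h3 : 1000 * ((d : ℝ) + 1) * L * (3 * α₄ * t) = 3000 * ((d : ℝ) + 1) * L * α₄ * t := by ring
      have h4 : 3000 * ((d : ℝ) + 1) * L * α₄ * t ≤ 3000 * ((d : ℝ) + 1) * L * α₄ * 1 := by
        have : 0 ≤ 3000 * ((d : ℝ) + 1) * L * α₄ := by positivity
        exact mul_le_mul_of_nonneg_left ht this
      linarith
    have hα₀s : 512 * ((d : ℝ) + 1) * ((d : ℝ) + 4) * L ^ 2 * α₀j ≤ 1 := by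
      have : 512 * ((d : ℝ) + 1) * ((d : ℝ) + 4) * L ^ 2 * α₀j =
          1024 * ((d : ℝ) + 1) * ((d : ℝ) + 4) * L ^ 2 * α₀ * t ^ 2 := by rw [hα₀j]; ring
      rw [this]
      have h0 : 0 ≤ 1024 * ((d : ℝ) + 1) * ((d : ℝ) + 4) * (L : ℝ) ^ 2 * α₀ := by positivity
      linarith [mul_le_mul_of_nonneg_left (ht2.trans ht) h0]
    have h9 := prop9_generalZ hLs hd hVU hα₀j0 h44 hS hB h3c h3d hα₄j hA0 (hα₃'.trans (by norm_num)) hq hs hα₀s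
    have eV : rescale L (bavgZ L V) = avgIterZ L U₀ (j + 1) := by rw [hVdef, avgIterZ_succ]
    have eU : (fun z => vtilGZ L V (utilGZ L U₀ u' u₁ j) (uavgZ L U₀ u₁ j) ((L : ℤ) • z)) = utilGZ L U₀ u' u₁ (j + 1) := by
      funext z; rw [utilGZ_succ]
    rw [eV, eU] at h9
    refine ⟨covBondBd_mono h9.1 ?_, siteBd_mono h9.2 ?_⟩
    · have := ineq205G (d := d) hL hα₀ hα₃ hα₄ hη ht hLt hs₃ hs₅ hs₆ hA0 le_rfl hT0 hT
      rw [hα₀j]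
      exact this
    · have := ineq206G (d := d) hα₀ hα₄ hη ht hs₃ hs₆ hL le_rfl
      rw [hα₀j]
      exact this

/-- ★ **Proposition 10 for the record, closed form**: under the hypotheses of `prop10_generalZ`, for all `j ≤ k`, `‖ũ′ʲ(c₋)⁻¹R̄ʲ_{0,c}ũ′ʲ(c₊) − 1‖ ≤ 2α₄Lʲη` and `‖ũ′ʲ − 1‖ ≤ C₆α₄`.
[cite: Balaban1985Averaging, Proposition 10 p.50, (203)–(204) p.49] -/
theorem prop10_generalZ' {L s : ℕ} (hLs : L = 2 * s + 1) (hs1 : 1 ≤ s) (hd : 1 ≤ d) {U₀ : SiteZ d → Fin d → 𝔸ˣ} {k : ℕ} {u' u₁ : SiteZ d → 𝔸ˣ}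
    {α₀ α₃ α₄ η : ℝ}
    (hV : ∀ j < k, ∀ (x : SiteZ d) (κ : Fin d), avgIterZ L U₀ j x κ ∈ U1 𝔸)
    (h52 : ∀ j < k, ∀ (x : SiteZ d) (κ μ : Fin d), κ ≠ μ →
      ‖((hol (avgIterZ L U₀ j) x (plaqWord κ μ) : 𝔸ˣ) : 𝔸) - 1‖ ≤ 2 * α₀ * ((L : ℝ) ^ j * η) ^ 2)
    (h176 : SiteBd u' α₄) (h177 : CovBondBd U₀ u' (α₄ * η)) (hu₁ : InLambdaZ L U₀ u₁ k α₃ η)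
    (hη : 0 ≤ η) (hk : (L : ℝ) ^ k * η ≤ 1) (hα₀ : 0 ≤ α₀) (hα₃ : 0 ≤ α₃) (hα₃' : α₃ ≤ 1 / 50) (hα₄ : 0 ≤ α₄)
    (hs₁ : 10 * C6 d * α₄ ≤ 1) (hs₂ : 3000 * ((d : ℝ) + 1) * L * α₄ ≤ 1) (hs₃ : C4G d L * (α₀ + α₃ + α₄) ≤ 1)
    (hs₄ : 1024 * ((d : ℝ) + 1) * ((d : ℝ) + 4) * L ^ 2 * α₀ ≤ 1) (hs₅ : 32 * ((d : ℝ) + 1) ^ 2 * C6 d * L ^ 2 * α₀ ≤ 1)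
    (hs₆ : 16 * d * C5' d * C6 d * (L : ℝ) ^ 2 * α₀ ≤ 1) :
    ∀ j ≤ k, CovBondBd (avgIterZ L U₀ j) (utilGZ L U₀ u' u₁ j) (2 * α₄ * ((L : ℝ) ^ j * η)) ∧
      SiteBd (utilGZ L U₀ u' u₁ j) (C6 d * α₄) := by
  intro j hj
  have hL : 2 ≤ L := by omega
  have hL1 : 1 ≤ L := by omega
  have ht := (pow_eta_le hL1 hη hk hj).1
  obtain ⟨hB, hS⟩ := prop10_generalZ hLs hs1 hd hV h52 h176 h177 hu₁ hη hk hα₀ hα₃ hα₃' hα₄ hs₁ hs₂ hs₃ hs₄ hs₅ hs₆ j hj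
  exact ⟨covBondBd_mono hB (rhs203G_le hα₄ hη ht hs₃), siteBd_mono hS (rhs204G_le hL hα₀ hα₄ hη ht hs₆)⟩

/-- **The level hypotheses of `prop10_generalZ` from (52)** (p. 49 «`α₀` replaced by `2α₀(Lʲη)²`», `η = L^{−k}`), for a background with values in an average-closed subgroup `G ⊂ U1` of the record's
average (`AvgClosedZ`): `B7Eq123GeneralRec.level_dataZ` (the record's Proposition 2 along the levels) read bondwise via `le_pdev`. [cite: Balaban1985Averaging, Proposition 2 (52)–(54) p.26, p.49] -/
theorem levels_of52Z {L : ℕ} (hL : 2 ≤ L) {G : Subgroup 𝔸ˣ} (hG : AvgClosedZ d L G) {U₀ : SiteZ d → Fin d → 𝔸ˣ}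
    (hU : ∀ x κ, U₀ x κ ∈ G) (k : ℕ) {α₀ : ℝ} (hα : 0 < α₀) (hα3 : C0Z d * α₀ ≤ 1 / 3) (hα4 : 4 * α₀ ≤ c2' d L)
    (h52 : pdev U₀ < α₀ * (((L : ℝ) ^ k)⁻¹) ^ 2) :
    (∀ j ≤ k, ∀ (x : SiteZ d) (κ : Fin d), avgIterZ L U₀ j x κ ∈ U1 𝔸) ∧
      ∀ j ≤ k, ∀ (x : SiteZ d) (κ μ : Fin d), κ ≠ μ →
        ‖((hol (avgIterZ L U₀ j) x (plaqWord κ μ) : 𝔸ˣ) : 𝔸) - 1‖ ≤ 2 * α₀ * ((L : ℝ) ^ j * ((L : ℝ) ^ k)⁻¹) ^ 2 := by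
  refine ⟨fun j hj => (level_dataZ L hL hG k U₀ hU hα hα3 hα4 h52 j hj).1, fun j hj x κ μ _ => ?_⟩
  obtain ⟨hU1, -, hp, -⟩ := level_dataZ L hL hG k U₀ hU hα hα3 hα4 h52 j hj
  have := (le_pdev hU1 x κ μ).trans hp.le
  linarith

/-- ★ **PROPOSITION 10 FOR THE RECORD UNDER (52)** — `prop10_generalZ'` with its level hypotheses discharged by `levels_of52Z`: for `U₀` with values in an average-closed subgroup `G ⊂ U1` satisfying (52)
`sup_p‖U₀(∂p) − 1‖ < α₀η²`, `η = L^{−k}`, and `u′, u₁` with (176), (177), (166)–(167) on centred blocks, the bounds (203)∕(204) (closed forms `2α₄Lʲη`, `C₆α₄`) hold for all `j ≤ k`.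
[cite: Balaban1985Averaging, Proposition 10 p.50, Proposition 2 p.26, (201)–(206) p.49; Balaban1987RG1, (0.4) p.253] -/
theorem prop10_generalZ_of52 {L s : ℕ} (hLs : L = 2 * s + 1) (hs1 : 1 ≤ s) (hd : 1 ≤ d) {G : Subgroup 𝔸ˣ} (hG : AvgClosedZ d L G)
    {U₀ : SiteZ d → Fin d → 𝔸ˣ} (hU : ∀ x κ, U₀ x κ ∈ G) {k : ℕ} {u' u₁ : SiteZ d → 𝔸ˣ} {α₀ α₃ α₄ : ℝ}
    (hα : 0 < α₀) (hα3 : C0Z d * α₀ ≤ 1 / 3) (hα4 : 4 * α₀ ≤ c2' d L)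
    (h52 : pdev U₀ < α₀ * (((L : ℝ) ^ k)⁻¹) ^ 2)
    (h176 : SiteBd u' α₄) (h177 : CovBondBd U₀ u' (α₄ * ((L : ℝ) ^ k)⁻¹))
    (hu₁ : InLambdaZ L U₀ u₁ k α₃ (((L : ℝ) ^ k)⁻¹))
    (hα₃ : 0 ≤ α₃) (hα₃' : α₃ ≤ 1 / 50) (hα₄ : 0 ≤ α₄)
    (hs₁ : 10 * C6 d * α₄ ≤ 1) (hs₂ : 3000 * ((d : ℝ) + 1) * L * α₄ ≤ 1) (hs₃ : C4G d L * (α₀ + α₃ + α₄) ≤ 1)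
    (hs₄ : 1024 * ((d : ℝ) + 1) * ((d : ℝ) + 4) * L ^ 2 * α₀ ≤ 1) (hs₅ : 32 * ((d : ℝ) + 1) ^ 2 * C6 d * L ^ 2 * α₀ ≤ 1)
    (hs₆ : 16 * d * C5' d * C6 d * (L : ℝ) ^ 2 * α₀ ≤ 1) :
    ∀ j ≤ k, CovBondBd (avgIterZ L U₀ j) (utilGZ L U₀ u' u₁ j) (2 * α₄ * ((L : ℝ) ^ j * ((L : ℝ) ^ k)⁻¹)) ∧
      SiteBd (utilGZ L U₀ u' u₁ j) (C6 d * α₄) := by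
  have hL : 2 ≤ L := by omega
  obtain ⟨hV, hP⟩ := levels_of52Z hL hG hU k hα hα3 hα4 h52
  have hη : (0 : ℝ) ≤ ((L : ℝ) ^ k)⁻¹ := by positivity
  have hk : (L : ℝ) ^ k * ((L : ℝ) ^ k)⁻¹ ≤ 1 := by rw [mul_inv_cancel₀ (by positivity)]
  exact prop10_generalZ' hLs hs1 hd (fun j hj => hV j hj.le) (fun j hj => hP j hj.le) h176 h177 hu₁ hη hk hα.le hα₃ hα₃' hα₄
    hs₁ hs₂ hs₃ hs₄ hs₅ hs₆

end Literature.MathematicalPhysics.QuantumFieldTheory.Balaban1983to89.B7Prop10GeneralRec
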